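import Mathlib
import Literature.AlgebraicGeometry.Tropical.TorusCycles
import Summits.HodgeConjecture.HodgeConjecture.Theorems.TropicalWeilObstructionTropicalWeilVanishingTransportCycles
import Summits.HodgeConjecture.HodgeConjecture.Theorems.TropicalWeilObstructionTropicalWeilVanishingGenericSpread
import Summits.HodgeConjecture.HodgeConjecture.Theorems.TropicalWeilObstructionTropicalWeilVanishingIsogenyDensity
import HarnessLib

/-!
# Transport to the identity — the registered stub `stub_transportToIdentity` of crux
# `TropicalWeilVanishing` (stmt-HodgeConjecture-18478, line `identity_transfer`), unfolded

Route `TropicalWeilObstruction` of `HodgeConjecture`. The skeleton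
`Cruxes/TropicalWeilVanishing/Lines/identity_transfer.lean` registers

`stub_transportToIdentity : (∃ Q, Q.PosDef ∧ Q J = J Q ∧ IsWeilGeneric 4 Q ∧ ∃ Z : TropicalTorusCycle 8 4 Q,
W(Z) ≠ 0) → ∃ Z₀ : TropicalTorusCycle 8 4 1, W(Z₀) ≠ 0 ∧ ∃ O open ∋ 1, ∀ Q' ∈ O symmetric
J-commuting, ∃ Z' over Q', SameType Z₀ Z'`

with the skeleton-local predicate `SameType` (not importable from `Theorems/`);
`transportToIdentity` below is that statement with `SameType` unfolded verbatim, so the skeleton closes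
by `fun h => transportToIdentity h`; `transportToIdentity_of_generic` is the same for every `n`.

Proof (Mikhalkin–Zharkov Prop. 4.3 / Zharkov §2, "Lemma 9.7"-type isogeny transport):
1. GENERIC SPREAD (`genericSpread`): the type `τ` of `Z` realises over every symmetric `J`-commuting
   `P` by an affine family of real data through the data of `Z`; on the open set `U ∋ Q` where all
   edge determinants stay positive and the Weil expression stays non-zero these are effective cycles.
2. DENSITY (`exists_integral_isogeny`): an integer `J`-commuting `F`, `det F = N ≠ 0`, and `λ > 0`
   with `λ (FᵀF)⁻¹ ∈ U`; put `P(Q') = λ F⁻¹ Q' F⁻ᵀ` (symmetric, `J`-commuting, continuous, `P(1) ∈ U`)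
   and `O = P⁻¹(U) ∋ 1`.
3. TRANSPORT (`transport_typeData`, `transport_realData`): for `Q' ∈ O` realise `τ` over `P(Q')`,
   scale by `s = N²/λ`, map by `F` (re-saturated frames `L'`, weights `w det R`) and push forward
   along `K = N adj(F)ᵀ` (`F · s P(Q') = Q' K`): an effective cycle over `Q'` whose type
   `(w', L', classes, re-orderings, K·shifts)` does not depend on `Q'`. `Z₀` is the cycle at `Q' = 1`;
   its Weil functional is `sⁿ det(A+iC)² · (Weil expression at P(1)) ≠ 0`
   (`transport_weilFunctional`, `complexOf_det_ne_zero`).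

Mathlib + the five sibling files `…TransportFrames/TransportCycles/GenericSection/GenericSpread/
IsogenyDensity`; no definition, no named fact, no sorry.

## References

* [MikhalkinZharkov2014Eigenwave] G. Mikhalkin, I. Zharkov, Tropical eigenwave and intermediate
  Jacobians, LN UMI 15 (2014), Def. 4.2, Prop. 4.3, Def. 6.1.
* [Zharkov2020TropicalWeil] I. Zharkov, Tropical abelian varieties, Weil classes and the Hodge
  conjecture, arXiv:2002.02347 (2020), §2 (pp. 2–4).
-/

-- `Summit.HodgeConjecture.HodgeConjecture.…` is the mandated namespace (single-conjunct summit).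
set_option linter.dupNamespace false

noncomputable section

open scoped BigOperators Matrix
open Matrix Literature.AlgebraicGeometry.Tropical

namespace Summit.HodgeConjecture.HodgeConjecture.Theorems.TropicalWeilVanishing

/-- **Transport to the identity (every `n`).** If a positive definite `J`-commuting Weil-generic
period `Q` carries an effective tropical `n`-cycle `Z` with `W(Z) ≠ 0`, then the standard torus
`ℝ²ⁿ/ℤ²ⁿ` carries an effective tropical `n`-cycle `Z₀` with `W(Z₀) ≠ 0` whose combinatorial type
(weights, frames, facet classes, re-orderings, shifts) realises over every symmetric `J`-commuting
period of an open neighbourhood of `1`. [cite: MikhalkinZharkov2014Eigenwave, Def. 4.2 and Prop. 4.3]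
[cite: Zharkov2020TropicalWeil, §2 (pp. 2–4)] -/
theorem transportToIdentity_of_generic {n : ℕ} {Q : Matrix (Fin (2 * n)) (Fin (2 * n)) ℝ}
    (hQ : Q.PosDef) (hQJ : Q * weilJ n = weilJ n * Q) (hgen : IsWeilGeneric n Q)
    (Z : TropicalTorusCycle (2 * n) n Q) (hWZ : weilFunctional Z ≠ 0) :
    ∃ Z₀ : TropicalTorusCycle (2 * n) n (1 : Matrix (Fin (2 * n)) (Fin (2 * n)) ℝ),
      weilFunctional Z₀ ≠ 0 ∧
      ∃ O : Set (Matrix (Fin (2 * n)) (Fin (2 * n)) ℝ), IsOpen O ∧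
        (1 : Matrix (Fin (2 * n)) (Fin (2 * n)) ℝ) ∈ O ∧
        ∀ Q' ∈ O, Q'.IsSymm → Q' * weilJ n = weilJ n * Q' →
          ∃ Z' : TropicalTorusCycle (2 * n) n Q',
            ∃ (hc : Z'.numCells = Z₀.numCells) (hf : Z'.numFacetClasses = Z₀.numFacetClasses),
              ∀ σ : Fin Z'.numCells,
                (Z'.cell σ).weight = (Z₀.cell (Fin.cast hc σ)).weight ∧
                (Z'.cell σ).frame = (Z₀.cell (Fin.cast hc σ)).frame ∧
                ∀ i : Fin (n + 1),
                  Fin.cast hf (Z'.facetClass σ i) = Z₀.facetClass (Fin.cast hc σ) i ∧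
                  Z'.facetPerm σ i = Z₀.facetPerm (Fin.cast hc σ) i ∧
                  Z'.facetShift σ i = Z₀.facetShift (Fin.cast hc σ) i := by
  classical
  -- 1. generic spread
  obtain ⟨V, T, Rf, hTcont, hTQ, hreal⟩ := genericSpread hQ hQJ hgen Z
  -- the open set `U ∋ Q`: positive edge determinants, non-zero Weil expression
  set U : Set (Matrix (Fin (2 * n)) (Fin (2 * n)) ℝ) := {P | (∀ σ, 0 < (T P σ).det) ∧
    (∑ σ, ((Z.cell σ).weight : ℂ) * (((T P σ).det / (n.factorial : ℝ) : ℝ) : ℂ) *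
      frameComplexDet n (Z.cell σ).frame ^ 2) ≠ 0} with hU
  have hUopen : IsOpen U := by
    have h1 : IsOpen {P : Matrix (Fin (2 * n)) (Fin (2 * n)) ℝ | ∀ σ, 0 < (T P σ).det} := by
      rw [Set.setOf_forall]
      exact isOpen_iInter_of_finite fun σ => isOpen_lt continuous_const (hTcont σ).matrix_det
    have h2 : IsOpen {P : Matrix (Fin (2 * n)) (Fin (2 * n)) ℝ |
        (∑ σ, ((Z.cell σ).weight : ℂ) * (((T P σ).det / (n.factorial : ℝ) : ℝ) : ℂ) *
          frameComplexDet n (Z.cell σ).frame ^ 2) ≠ 0} := by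
      refine isOpen_ne_fun ?_ continuous_const
      refine continuous_finsetSum _ fun σ _ => ?_
      exact (continuous_const.mul (Complex.continuous_ofReal.comp
        ((hTcont σ).matrix_det.div_const _))).mul continuous_const
    exact h1.inter h2
  have hQU : Q ∈ U := by
    refine ⟨fun σ => by rw [hTQ σ]; exact (Z.cell σ).edgeCoeff_det_pos, ?_⟩
    have e : (∑ σ, ((Z.cell σ).weight : ℂ) * (((T Q σ).det / (n.factorial : ℝ) : ℝ) : ℂ) *
        frameComplexDet n (Z.cell σ).frame ^ 2) = weilFunctional Z := by
      unfold weilFunctional TropicalCell.latticeVolume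
      exact Finset.sum_congr rfl fun σ _ => by rw [hTQ σ]
    rw [e]; exact hWZ
  -- 2. density: the integral isogeny `F` and the scale `λ`
  obtain ⟨F, lam, hFdet, hFJ, hlam, hmem⟩ := exists_integral_isogeny hQ hQJ U hUopen hQU
  obtain ⟨hF1, hF2⟩ := blocks_of_commute_weilJ F hFJ
  set Fr : Matrix (Fin (2 * n)) (Fin (2 * n)) ℝ := F.map ((↑) : ℤ → ℝ) with hFr
  have hFrdet : Fr.det ≠ 0 := by
    rw [hFr, ← Int.cast_det]; exact_mod_cast hFdet
  have hFrunit : IsUnit Fr.det := isUnit_iff_ne_zero.2 hFrdet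
  set Nr : ℝ := (F.det : ℝ) with hNr
  have hNr0 : Nr ≠ 0 := by rw [hNr]; exact_mod_cast hFdet
  -- the inverse and its relation to the adjugate
  have hinv1 : Fr * Fr⁻¹ = 1 := Matrix.mul_nonsing_inv Fr hFrunit
  have hinv2 : Fr⁻¹ * Fr = 1 := Matrix.nonsing_inv_mul Fr hFrunit
  have hadj : Nr • Fr⁻¹ = Fr.adjugate := by
    rw [Matrix.inv_def, Ring.inverse_eq_inv', smul_smul, hNr, hFr, ← Int.cast_det,
      mul_inv_cancel₀ (by exact_mod_cast hFdet), one_smul]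
  have hadjmap : Fr.adjugate = F.adjugate.map ((↑) : ℤ → ℝ) := by
    have h := RingHom.map_adjugate (Int.castRingHom ℝ) F
    rw [RingHom.mapMatrix_apply, RingHom.mapMatrix_apply] at h
    rw [hFr]
    exact h.symm
  -- the integral push-forward matrix `K = N adj(F)ᵀ` and the scale `s = N² / λ`
  set K : Matrix (Fin (2 * n)) (Fin (2 * n)) ℤ := Matrix.of fun a b => F.det * F.adjugate b a with hK
  have hKr : K.map ((↑) : ℤ → ℝ) = Nr • (Nr • Fr⁻¹)ᵀ := by
    rw [hadj, hadjmap]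
    ext a b
    simp [hK, Matrix.map_apply, Matrix.transpose_apply, hNr]
  set s : ℝ := Nr ^ 2 / lam with hs
  have hspos : 0 < s := div_pos (by positivity) hlam
  have hslam : s * lam = Nr * Nr := by rw [hs, div_mul_cancel₀ _ hlam.ne', pow_two]
  -- the congruence `P(Q') = λ F⁻¹ Q' F⁻ᵀ`
  obtain ⟨Pm, hPm⟩ : ∃ Pm : Matrix (Fin (2 * n)) (Fin (2 * n)) ℝ → Matrix (Fin (2 * n)) (Fin (2 * n)) ℝ,
      Pm = fun Q' => lam • (Fr⁻¹ * Q' * Fr⁻¹ᵀ) := ⟨_, rfl⟩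
  have hKeq : ∀ Q', Fr * (s • Pm Q') = Q' * K.map ((↑) : ℤ → ℝ) := by
    intro Q'
    rw [hPm, hKr, Matrix.transpose_smul, smul_smul, Matrix.mul_smul, smul_smul, Matrix.mul_smul,
      hslam, ← Matrix.mul_assoc, ← Matrix.mul_assoc, hinv1, Matrix.one_mul]
  have hFrinvJ : Fr⁻¹ * weilJ n = weilJ n * Fr⁻¹ := by
    have h1 : Fr⁻¹ * (Fr * weilJ n) * Fr⁻¹ = Fr⁻¹ * (weilJ n * Fr) * Fr⁻¹ := by rw [hFJ]
    rw [← Matrix.mul_assoc, hinv2, Matrix.one_mul, Matrix.mul_assoc, Matrix.mul_assoc, hinv1,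
      Matrix.mul_one] at h1
    exact h1.symm
  have hFrinvTJ : Fr⁻¹ᵀ * weilJ n = weilJ n * Fr⁻¹ᵀ := by
    have h := congrArg Matrix.transpose hFrinvJ
    rw [Matrix.transpose_mul, Matrix.transpose_mul, TropicalWeilSupply.Negative.weilJ_transpose,
      Matrix.neg_mul, Matrix.mul_neg, neg_inj] at h
    exact h.symm
  have hPsymm : ∀ Q' : Matrix (Fin (2 * n)) (Fin (2 * n)) ℝ, Q'.IsSymm → (Pm Q').IsSymm := by
    intro Q' hS'
    rw [hPm]
    show (lam • (Fr⁻¹ * Q' * Fr⁻¹ᵀ))ᵀ = lam • (Fr⁻¹ * Q' * Fr⁻¹ᵀ)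
    rw [Matrix.transpose_smul, Matrix.transpose_mul, Matrix.transpose_mul, Matrix.transpose_transpose,
      hS'.eq, Matrix.mul_assoc]
  have hPJ : ∀ Q' : Matrix (Fin (2 * n)) (Fin (2 * n)) ℝ, Q' * weilJ n = weilJ n * Q' →
      Pm Q' * weilJ n = weilJ n * Pm Q' := by
    intro Q' hJ'
    rw [hPm]
    show lam • (Fr⁻¹ * Q' * Fr⁻¹ᵀ) * weilJ n = weilJ n * (lam • (Fr⁻¹ * Q' * Fr⁻¹ᵀ))
    rw [Matrix.smul_mul, Matrix.mul_smul, Matrix.mul_assoc, hFrinvTJ, ← Matrix.mul_assoc,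
      Matrix.mul_assoc Fr⁻¹, hJ', ← Matrix.mul_assoc, hFrinvJ, Matrix.mul_assoc, Matrix.mul_assoc,
      Matrix.mul_assoc]
  have hPcont : Continuous Pm := by
    rw [hPm]
    exact ((continuous_const.matrix_mul continuous_id).matrix_mul continuous_const).const_smul lam
  have hP1 : Pm 1 ∈ U := by
    rw [hPm]
    show lam • (Fr⁻¹ * 1 * Fr⁻¹ᵀ) ∈ U
    rw [Matrix.mul_one, Matrix.transpose_nonsing_inv, ← Matrix.mul_inv_rev]
    exact hmem
  -- 3. transport of the type data of `Z` along `F`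
  obtain ⟨w', L', R, hw'pos, hsat', hfac, hRdet, hw'eq, hbal'⟩ :=
    transport_typeData (fun σ => (Z.cell σ).weight) (fun σ => (Z.cell σ).weight_pos)
      (fun σ => (Z.cell σ).frame) (fun σ => (Z.cell σ).frame_saturated) Z.facetClass Z.facetPerm
      Z.balanced F hFdet
  -- real data over every `Q' ∈ O = P⁻¹(U)`, symmetric and `J`-commuting
  have hdata : ∀ Q' : Matrix (Fin (2 * n)) (Fin (2 * n)) ℝ, Pm Q' ∈ U → Q'.IsSymm →
      Q' * weilJ n = weilJ n * Q' →
      (∀ (σ : Fin Z.numCells) (j : Fin n) (a : Fin (2 * n)),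
          (Fr *ᵥ (s • V (Pm Q') σ j.succ)) a - (Fr *ᵥ (s • V (Pm Q') σ 0)) a =
            ∑ m, (L' σ a m : ℝ) * ((R σ).map ((↑) : ℤ → ℝ) * (s • T (Pm Q') σ)) m j) ∧
      (∀ σ : Fin Z.numCells, 0 < ((R σ).map ((↑) : ℤ → ℝ) * (s • T (Pm Q') σ)).det) ∧
      (∀ (σ : Fin Z.numCells) (i : Fin (n + 1)) (j : Fin n) (a : Fin (2 * n)),
          (Fr *ᵥ (s • V (Pm Q') σ (i.succAbove (Z.facetPerm σ i j)))) a =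
            (Fr *ᵥ (s • Rf (Pm Q') (Z.facetClass σ i) j)) a +
              ∑ b, Q' a b * ((K *ᵥ Z.facetShift σ i) b : ℝ)) := by
    intro Q' hU' hS' hJ'
    obtain ⟨hv, hfe⟩ := hreal (Pm Q') (hPsymm Q' hS') (hPJ Q' hJ')
    exact transport_realData (fun σ => (Z.cell σ).frame) Z.facetClass Z.facetPerm Z.facetShift
      (Pm Q') (V (Pm Q')) (T (Pm Q')) (Rf (Pm Q')) hv (hU'.1) hfe F L' R hfac hRdet s hspos K Q'
      (hKeq Q')
  -- the transported cycle over `Q'` (same discrete data for all `Q'`)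
  let mk : ∀ Q' : Matrix (Fin (2 * n)) (Fin (2 * n)) ℝ, Pm Q' ∈ U → Q'.IsSymm →
      Q' * weilJ n = weilJ n * Q' → TropicalTorusCycle (2 * n) n Q' :=
    fun Q' hU' hS' hJ' =>
      { numCells := Z.numCells
        cell := fun σ =>
          { weight := w' σ
            weight_pos := hw'pos σ
            vertex := fun j => Fr *ᵥ (s • V (Pm Q') σ j)
            frame := L' σ
            edgeCoeff := (R σ).map ((↑) : ℤ → ℝ) * (s • T (Pm Q') σ)
            vertex_succ_sub := (hdata Q' hU' hS' hJ').1 σ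
            edgeCoeff_det_pos := (hdata Q' hU' hS' hJ').2.1 σ
            frame_saturated := hsat' σ }
        numFacetClasses := Z.numFacetClasses
        refFacet := fun f j => Fr *ᵥ (s • Rf (Pm Q') f j)
        facetClass := Z.facetClass
        facetPerm := Z.facetPerm
        facetShift := fun σ i => K *ᵥ Z.facetShift σ i
        facet_eq := (hdata Q' hU' hS' hJ').2.2
        balanced := hbal' }
  have h1S : (1 : Matrix (Fin (2 * n)) (Fin (2 * n)) ℝ).IsSymm := Matrix.isSymm_one
  have h1J : (1 : Matrix (Fin (2 * n)) (Fin (2 * n)) ℝ) * weilJ n = weilJ n * 1 := by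
    rw [Matrix.one_mul, Matrix.mul_one]
  refine ⟨mk 1 hP1 h1S h1J, ?_, Pm ⁻¹' U, hUopen.preimage hPcont, hP1, ?_⟩
  · -- `W(Z₀) = sⁿ det(A + iC)² · (Weil expression at P(1)) ≠ 0`
    show (∑ σ : Fin Z.numCells, ((w' σ : ℕ) : ℂ) *
        ((((R σ).map ((↑) : ℤ → ℝ) * (s • T (Pm 1) σ)).det / (n.factorial : ℝ) : ℝ) : ℂ) *
        frameComplexDet n (L' σ) ^ 2) ≠ 0
    rw [transport_weilFunctional (fun σ => (Z.cell σ).weight) w' (fun σ => (Z.cell σ).frame) L' R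
      (fun σ => T (Pm 1) σ) F hF1 hF2 hfac hw'eq s]
    refine mul_ne_zero (mul_ne_zero ?_ (pow_ne_zero 2 (complexOf_det_ne_zero F hF1 hF2 hFdet))) hP1.2
    exact_mod_cast (pow_pos hspos n).ne'
  · intro Q' hQ'U hS' hJ'
    exact ⟨mk Q' hQ'U hS' hJ', rfl, rfl, fun σ => ⟨rfl, rfl, fun i => ⟨rfl, rfl, rfl⟩⟩⟩

/-- **The registered stub `stub_transportToIdentity`** of
`Cruxes/TropicalWeilVanishing/Lines/identity_transfer.lean` (`n = 4`), with the skeleton-local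
predicate `SameType` unfolded verbatim: the skeleton closes it by `fun h => transportToIdentity h`.
[cite: MikhalkinZharkov2014Eigenwave, Def. 4.2 and Prop. 4.3] [cite: Zharkov2020TropicalWeil, §2 (pp. 2–4)] -/
theorem transportToIdentity :
    (∃ Q : Matrix (Fin (2 * 4)) (Fin (2 * 4)) ℝ, Q.PosDef ∧
        Q * weilJ 4 = weilJ 4 * Q ∧ IsWeilGeneric 4 Q ∧
        ∃ Z : TropicalTorusCycle (2 * 4) 4 Q, weilFunctional Z ≠ 0) →
    ∃ Z₀ : TropicalTorusCycle (2 * 4) 4 (1 : Matrix (Fin (2 * 4)) (Fin (2 * 4)) ℝ),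
      weilFunctional Z₀ ≠ 0 ∧
      ∃ O : Set (Matrix (Fin (2 * 4)) (Fin (2 * 4)) ℝ), IsOpen O ∧
        (1 : Matrix (Fin (2 * 4)) (Fin (2 * 4)) ℝ) ∈ O ∧
        ∀ Q' ∈ O, Q'.IsSymm → Q' * weilJ 4 = weilJ 4 * Q' →
          ∃ Z' : TropicalTorusCycle (2 * 4) 4 Q',
            ∃ (hc : Z'.numCells = Z₀.numCells) (hf : Z'.numFacetClasses = Z₀.numFacetClasses),
              ∀ σ : Fin Z'.numCells,
                (Z'.cell σ).weight = (Z₀.cell (Fin.cast hc σ)).weight ∧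
                (Z'.cell σ).frame = (Z₀.cell (Fin.cast hc σ)).frame ∧
                ∀ i : Fin (4 + 1),
                  Fin.cast hf (Z'.facetClass σ i) = Z₀.facetClass (Fin.cast hc σ) i ∧
                  Z'.facetPerm σ i = Z₀.facetPerm (Fin.cast hc σ) i ∧
                  Z'.facetShift σ i = Z₀.facetShift (Fin.cast hc σ) i := by
  rintro ⟨Q, hQ, hQJ, hgen, Z, hW⟩
  exact transportToIdentity_of_generic hQ hQJ hgen Z hW

end Summit.HodgeConjecture.HodgeConjecture.Theorems.TropicalWeilVanishing

end
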